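import Summits.QuantumFields.GaugeBoot.PeriodicLoopEquation
import Summits.QuantumFields.GaugeBoot.TiltedBox
import HarnessLib

/-!
# The periodic loop equation: the cubic torus and the 45°-tilted box as instances (gauge-boot, periodic loop equations, supplement)

HONEST FRAMING (cell `pub-gaugeboot`, page 1 of every file): the venture produces certified bounds
on lattice expectations at stated coupling, gauge group, dimension and torus size; NOT a mass gap,
NOT a continuum limit, NOT a string tension; NOT Yang–Mills-summit-bearing (barriers
`FixedCouplingUltralocality`, `PerturbativeInvisibility`).

The loop-equation stack over the periodic lattice `(A, e)` (`PeriodicWords.lean` …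
`PeriodicLoopEquation.lean`) specialised to the two lattices the cell uses:

* **the cubic torus** `A = Site d L = (ℤ/L)^d`, `e = cubicUnit` (unit vectors): the periodic word
  calculus IS the tree's torus word calculus (`Step.move = Step.apply`, `Step.link = Step.edge`,
  `Word.endpoint`, `wordHolonomy`, `holonomy = plaquetteHolonomy`, `wilsonAction` agree
  definitionally) and the periodic Wilson measure IS the tree's `wilsonMeasure`
  (`gibbs_cubicUnit_eq_wilsonMeasure`, continuous `ρ`: `Measure.tilted` versus the `Z⁻¹`-normalised
  `withDensity`), so `TiltedRP.loopEquation_specialUnitaryGroup` at `e = cubicUnit` is the torus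
  loop equation of `LoopEquation.lean` (`splitTerm_cubicUnit`, `plaqTerm_cubicUnit`);
* **the 45°-tilted box** `A = TiltedSite d i j M_u M_v L`, `e = tiltedUnit`:
  `tiltedBox_loopEquation_suN` / `_uN` — the single-link loop equation for `SU(N)` / `U(N)` on every
  tilted box (condition (a) of the tribunal's item (4), t1.md v2.3 A8/A13, now a theorem).

Everything is `[folklore]`.

References: V. Kazakov, Z. Zheng, arXiv:2404.16925 §2.3; S. Cao, M. Park, S. Sheffield, Comm. AMS 5
(2025), Thm. 5.7 (`U(N)`) / Thm. 6.104 (`SU(N)`) (arXiv:2307.06790 numbering; informally Thm. 1.14);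
 J. Fröhlich, R. Israel, E. H. Lieb, B. Simon, J. Stat. Phys. 22 (1980) 297, §3.
-/

noncomputable section

open MeasureTheory
open Literature.MathematicalPhysics.QuantumFieldTheory (Site GaugeConfig plaquetteHolonomy wilsonMeasure
  haarProbability)
open Literature.MathematicalPhysics.QuantumLattice (fundamentalRep unitaryFundamentalRep fundamentalLatticeRep)

namespace Summit.QuantumFields.GaugeBoot

namespace TiltedRP

/-! ## The cubic torus as a periodic lattice -/

section Cubic

variable (d L : ℕ)

/-- The marked translations of the cubic torus `(ℤ/L)^d`: the unit vectors `e_k`. [folklore] -/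
def cubicUnit : Fin d → Site d L := fun k => Pi.single k 1

variable {d L} {N : ℕ} {G : Type} [Group G]

/-- On the cubic torus `Step.move` is the torus `Step.apply`. [folklore] -/
@[simp] theorem move_cubicUnit (x : Site d L) (s : Step d) : s.move (cubicUnit d L) x = s.apply x := by
  cases s <;> rfl

/-- On the cubic torus `Step.link` is the torus `Step.edge`. [folklore] -/
@[simp] theorem link_cubicUnit (x : Site d L) (s : Step d) : s.link (cubicUnit d L) x = s.edge x := by
  cases s <;> rfl

/-- On the cubic torus the periodic endpoint is the torus endpoint. [folklore] -/
@[simp] theorem endpoint_cubicUnit (x : Site d L) (w : Word d) :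
    Word.endpoint (cubicUnit d L) x w = GaugeBoot.Word.endpoint x w := by
  induction w generalizing x with
  | nil => rfl
  | cons s w ih => simp [ih]

/-- On the cubic torus the periodic `siteAt` is the torus `siteAt`. [folklore] -/
@[simp] theorem siteAt_cubicUnit (x : Site d L) (w : Word d) (k : ℕ) :
    Word.siteAt (cubicUnit d L) x w k = GaugeBoot.Word.siteAt x w k := by
  rw [Word.siteAt, GaugeBoot.Word.siteAt, endpoint_cubicUnit]

/-- On the cubic torus the periodic step holonomy is the torus step holonomy. [folklore] -/
@[simp] theorem stepHolonomy_cubicUnit (U : GaugeConfig d L G) (x : Site d L) (s : Step d) :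
    stepHolonomy (cubicUnit d L) U x s = GaugeBoot.stepHolonomy U x s := by
  cases s <;> rfl

/-- On the cubic torus the periodic word holonomy is the torus word holonomy. [folklore] -/
@[simp] theorem wordHolonomy_cubicUnit (U : GaugeConfig d L G) (x : Site d L) (w : Word d) :
    wordHolonomy (cubicUnit d L) U x w = GaugeBoot.wordHolonomy U x w := by
  induction w generalizing x with
  | nil => rfl
  | cons s w ih => simp [ih]

/-- On the cubic torus the periodic plaquette holonomy is the torus plaquette holonomy. [folklore] -/
theorem holonomy_cubicUnit (U : GaugeConfig d L G) (x : Site d L) (i j : Fin d) :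
    holonomy (cubicUnit d L) U x i j = plaquetteHolonomy U x i j := rfl

variable (ρ : G →* Matrix (Fin N) (Fin N) ℂ)

/-- On the cubic torus the periodic Wilson action is the torus Wilson action. [folklore] -/
theorem wilsonAction_cubicUnit [NeZero L] (U : GaugeConfig d L G) :
    wilsonAction ρ (cubicUnit d L) U =
      Literature.MathematicalPhysics.QuantumFieldTheory.wilsonAction ρ U := rfl

/-- On the cubic torus the periodic split terms are the torus split terms. [folklore] -/
theorem splitTerm_cubicUnit (s : ℂ) (x : Site d L) (μ : Fin d) (U : GaugeConfig d L G) (w : Word d)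
    (k : ℕ) : splitTerm ρ (cubicUnit d L) s x μ U w k = GaugeBoot.splitTerm ρ s x μ U w k := by
  unfold splitTerm GaugeBoot.splitTerm
  simp only [link_cubicUnit, siteAt_cubicUnit, wordHolonomy_cubicUnit]
  rfl

/-- On the cubic torus the periodic plaquette terms are the torus plaquette terms. [folklore] -/
theorem plaqTerm_cubicUnit (s : ℂ) (x : Site d L) (μ : Fin d) (U : GaugeConfig d L G) (w : Word d)
    (ν : Fin d) (ε : Bool) :
    plaqTerm ρ (cubicUnit d L) s x μ U w ν ε = GaugeBoot.plaqTerm ρ s x μ U w ν ε := by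
  unfold plaqTerm GaugeBoot.plaqTerm
  simp only [wordHolonomy_cubicUnit]

variable [TopologicalSpace G] [IsTopologicalGroup G] [CompactSpace G] [MeasurableSpace G] [BorelSpace G]
  [SecondCountableTopology G]

/-- **On the cubic torus the periodic Wilson measure `gibbs` is the tree's `wilsonMeasure`**
(continuous `ρ`, every real `β`): `Measure.tilted` by `−βS` versus the `Z⁻¹`-normalised
`withDensity e^{−βS}` of `ConstructiveQFTWave0.lean`. [folklore] -/
theorem gibbs_cubicUnit_eq_wilsonMeasure [NeZero L] (hρ : Continuous ρ) (β : ℝ) :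
    gibbs ρ (cubicUnit d L) β = wilsonMeasure (d := d) (L := L) ρ β := by
  haveI := isProbabilityMeasure_productHaar (A := Site d L) (d := d) (G := G)
  set Z := ∫ U, Real.exp (-β * wilsonAction ρ (cubicUnit d L) U) ∂(productHaar (Site d L) d G) with hZ
  have hZpos : 0 < Z := normaliser_pos ρ hρ (cubicUnit d L) β
  have hint := integrable_boltzmann ρ hρ (cubicUnit d L) β
  have hgm : Measurable fun U : Config (Site d L) d G =>
      ENNReal.ofReal (Real.exp (-β * wilsonAction ρ (cubicUnit d L) U)) :=
    (continuous_boltzmann ρ hρ (cubicUnit d L) β).measurable.ennreal_ofReal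
  -- the tree's partition function is `ofReal Z`
  have hZ' : Literature.MathematicalPhysics.QuantumFieldTheory.partitionFunction (d := d) (L := L) ρ β =
      ENNReal.ofReal Z := by
    show ((Measure.pi fun _ : Literature.MathematicalPhysics.QuantumFieldTheory.Edge d L =>
        haarProbability G).withDensity fun U => ENNReal.ofReal
          (Real.exp (-β * Literature.MathematicalPhysics.QuantumFieldTheory.wilsonAction ρ U))) Set.univ =
      ENNReal.ofReal Z
    rw [withDensity_apply _ MeasurableSet.univ, Measure.restrict_univ, hZ,
      ofReal_integral_eq_lintegral_ofReal hint (ae_of_all _ fun U => (Real.exp_pos _).le)]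
    rfl
  -- both sides are `(ofReal Z)⁻¹ • π.withDensity e^{-βS}`
  have hdens : (fun U : Config (Site d L) d G => ENNReal.ofReal
      (Real.exp (-β * wilsonAction ρ (cubicUnit d L) U) / Z)) =
      (ENNReal.ofReal Z)⁻¹ • fun U => ENNReal.ofReal (Real.exp (-β * wilsonAction ρ (cubicUnit d L) U)) := by
    funext U
    rw [Pi.smul_apply, smul_eq_mul, ENNReal.ofReal_div_of_pos hZpos, div_eq_mul_inv, mul_comm]
  unfold gibbs Measure.tilted
  rw [← hZ, hdens, withDensity_smul _ hgm]
  unfold wilsonMeasure Literature.MathematicalPhysics.QuantumFieldTheory.wilsonWeight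
  rw [hZ']
  rfl

/-- **The periodic `SU(N)` loop equation at `e = cubicUnit` is the torus loop equation** of
`LoopEquation.lean` (same split and plaquette terms, same measure). [folklore] -/
theorem loopEquation_specialUnitaryGroup_cubicUnit [NeZero L] (N : ℕ) (β : ℝ) (x : Site d L)
    (μ : Fin d) (w : Word d) (hw : GaugeBoot.Word.endpoint x w = x) :
    (∑ k ∈ Finset.range w.length, ∫ U, GaugeBoot.splitTerm (fundamentalRep (Fin N)) 1 x μ U w k
        ∂(wilsonMeasure (d := d) (L := L) (fundamentalRep (Fin N)) β)) +
      (β / 2 : ℂ) * ∑ ν ∈ Finset.univ.erase μ, ∑ ε : Bool,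
        ∫ U, GaugeBoot.plaqTerm (fundamentalRep (Fin N)) 1 x μ U w ν ε
          ∂(wilsonMeasure (d := d) (L := L) (fundamentalRep (Fin N)) β) = 0 := by
  haveI : SecondCountableTopology (Matrix.specialUnitaryGroup (Fin N) ℂ) :=
    ((fundamentalLatticeRep N).continuous.isClosedEmbedding
      (fundamentalLatticeRep N).injective).isEmbedding.secondCountableTopology
  have h := loopEquation_specialUnitaryGroup N (cubicUnit d L) β x μ w (by simpa using hw)
  simpa only [splitTerm_cubicUnit, plaqTerm_cubicUnit,
    gibbs_cubicUnit_eq_wilsonMeasure (fundamentalRep (Fin N)) (fundamentalLatticeRep N).continuous β]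
    using h

end Cubic

/-! ## The 45°-tilted periodic box -/

section Box

variable {d : ℕ} {i j : Fin d} {Mu Mv L : ℕ} [NeZero Mu] [NeZero Mv] [NeZero L]

/-- **The single-link loop equation for `SU(N)` lattice Yang–Mills on the 45°-tilted periodic box**
`ℤ^d / Γ(M_u, M_v, L)` (Wilson action, every real `β`, `s = 1`): for every link `(x, μ)` of the box
and every word `w` closed at `x`, `Σ_k E[splitTerm_k] + (β/2)·Σ_{ν≠μ,ε=±} E[plaqTerm_{ν,ε}] = 0`,
`E` the expectation in `gibbs (fundamentalRep (Fin N)) tiltedUnit β`. This is the L1 standard ("the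
loop equation is a lemma, never silent") for the rows of a tilted-box certificate. [folklore] -/
theorem tiltedBox_loopEquation_suN [DecidableEq (TiltedSite d i j Mu Mv L)] (N : ℕ) (β : ℝ)
    (x : TiltedSite d i j Mu Mv L) (μ : Fin d) (w : Word d)
    (hw : Word.endpoint (tiltedUnit d i j Mu Mv L) x w = x) :
    (∑ k ∈ Finset.range w.length,
        ∫ U, splitTerm (fundamentalRep (Fin N)) (tiltedUnit d i j Mu Mv L) 1 x μ U w k
          ∂(gibbs (fundamentalRep (Fin N)) (tiltedUnit d i j Mu Mv L) β)) +
      (β / 2 : ℂ) * ∑ ν ∈ Finset.univ.erase μ, ∑ ε : Bool,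
        ∫ U, plaqTerm (fundamentalRep (Fin N)) (tiltedUnit d i j Mu Mv L) 1 x μ U w ν ε
          ∂(gibbs (fundamentalRep (Fin N)) (tiltedUnit d i j Mu Mv L) β) = 0 :=
  loopEquation_specialUnitaryGroup N (tiltedUnit d i j Mu Mv L) β x μ w hw

/-- **The single-link loop equation for `U(N)` on the 45°-tilted periodic box** (`s = 0`).
[folklore] -/
theorem tiltedBox_loopEquation_uN [DecidableEq (TiltedSite d i j Mu Mv L)] (N : ℕ) (β : ℝ)
    (x : TiltedSite d i j Mu Mv L) (μ : Fin d) (w : Word d)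
    (hw : Word.endpoint (tiltedUnit d i j Mu Mv L) x w = x) :
    (∑ k ∈ Finset.range w.length,
        ∫ U, splitTerm (unitaryFundamentalRep (Fin N) ℂ) (tiltedUnit d i j Mu Mv L) 0 x μ U w k
          ∂(gibbs (unitaryFundamentalRep (Fin N) ℂ) (tiltedUnit d i j Mu Mv L) β)) +
      (β / 2 : ℂ) * ∑ ν ∈ Finset.univ.erase μ, ∑ ε : Bool,
        ∫ U, plaqTerm (unitaryFundamentalRep (Fin N) ℂ) (tiltedUnit d i j Mu Mv L) 0 x μ U w ν ε
          ∂(gibbs (unitaryFundamentalRep (Fin N) ℂ) (tiltedUnit d i j Mu Mv L) β) = 0 :=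
  loopEquation_unitaryGroup N (tiltedUnit d i j Mu Mv L) β x μ w hw

end Box

end TiltedRP

end Summit.QuantumFields.GaugeBoot

end
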